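import Summits.AtomisticToContinuum.Crystallization.Theses.PalmUnimodularRigidity
import Summits.AtomisticToContinuum.Crystallization.Theorems.MinimiserShells.Negative.LoadBearing
import Summits.AtomisticToContinuum.Crystallization.Theorems.MinimiserShells.Negative.Rootedness
import Literature.Probability.Process.PointStationaryLaw
import Literature.MathematicalPhysics.StatisticalMechanics.RootEnergy
import Literature.MathematicalPhysics.StatisticalMechanics.MuGSC

/-!
# Line `equilibrium-in-law-surgery` — lead's skeleton for crux `MinimiserShells` (stmt-AtomisticToContinuum-9225)

Route `route-AtomisticToContinuum-PalmUnimodularRigidity`; crux decl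
`Summit.AtomisticToContinuum.Crystallization.Theses.PalmUnimodularRigidity.MinimiserShells`, concluded BY NAME by
`MinimiserShells_of` (hypotheses = the six registered stub statements, real proof) and by the closed term
`MinimiserShells_proof : MinimiserShells := MinimiserShells_of stub_… … stub_…`.
Line card: `Cruxes/MinimiserShells/Lines/equilibrium-in-law-surgery.md` (planner gen 2).  Lead reshape r1 (2026-08-16,
prover-line-stmt-AtomisticToContinuum-9225-0): the six stub SIGNATURES are now written purely in TREE vocabulary —
`eStar` / `meanRootEnergy` / `GoodShell` of the landed `Theorems/MinimiserShells/Negative/LoadBearing.lean` (the route's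
inlined terms verbatim, `minimiserShells_iff` is `Iff.rfl` there), `IsRootedHardCore` / `IsPointStationaryLaw`
(Literature.Probability.Process), `IsMuGSC` / `UniformlyDiscrete` (Literature StatisticalMechanics.MuGSC) and the
route decl `UnimodularEnergyLowerBound` — so that every stub can be landed verbatim as a `Theorems/` file and cited here by
name (no skeleton-local definition occurs in any stub signature; `GoodShellIn S y` of gen 2 is inlined as
`GoodShell (count.restrict ((· - y) '' S))`).  Mathematical content unchanged from gen 2.

## The line
LEVER (`stub_equilibriumInLaw`): a minimising point-stationary hard-core law minimises the LINEAR functional `E_P[h]` over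
the cone of point-stationary hard-core laws at the value `e*` (item 9229 = `stub_energyFloor`); sparse equivariant
surgery (one uniform grid phase, `(Mℤ)³`-sparse active cells) + first variation + Mecke localisation ⇒ `P`-a.s. the
configuration is a Sütő `μ`GSC of Lennard-Jones at `μ = e*` (`IsMuGSC lennardJones eStar S`).
TRANSFER: deterministic SURFACE ORDER of badly-shelled atoms in e*-μGSCs (`stub_dlrSurfaceOrder`, the open core) and
VOLUME GROWTH (`stub_dlrVolumeGrowth`, capillarity), then the Palm density lemma (`stub_palmDensity`, one mass transport,
`P(bad root) ≤ C/(cR)` for every `R ≥ 1`) with the shell event's Giry-measurability (`stub_goodShellMeasurable`).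
Disproof.lean (gen 2) cross-check per stub: see the line card; no stub is an instance of a landed Negative lemma.
-/

noncomputable section

open MeasureTheory
open scoped ENNReal BigOperators

namespace Summit.AtomisticToContinuum.Crystallization.Cruxes.MinimiserShells.EquilibriumInLawSurgery

open Literature.Probability.Process (IsPointStationaryLaw IsRootedHardCore count_restrict_singleton_ne_zero_iff)
open Literature.MathematicalPhysics.StatisticalMechanics (lennardJones IsMuGSC UniformlyDiscrete)
open Summit.AtomisticToContinuum.Crystallization.Theses.PalmUnimodularRigidity
  (MinimiserShells UnimodularEnergyLowerBound)
open Summit.AtomisticToContinuum.Crystallization.Theorems.MinimiserShells.Negative.LoadBearing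
  (eStar meanRootEnergy GoodShell minimiserShells_iff)

/-! ## Registered stubs (the only `sorry`s of the line; signatures in tree vocabulary) -/

/-- **stub_equilibriumInLaw** (S1, the LEVER; L/XL; true modulo 9229, which it takes by name): for every `δ > 0` and
every minimising point-stationary `δ`-hard-core probability law `P`, `P`-almost every configuration is the counting
measure of a `μ`GSC of Lennard-Jones at `μ = e*` (zero-temperature DLR ground state at the bulk chemical potential).
Plan: random-grid sparse surgery (one uniform phase), re-root at the new atoms (stays in the point-stationary cone),
bookkeeping by mass transport, 9229 for the surgered law + `E_P[h] ≤ e*` ⇒ first variation `≥ 0` for every local rule,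
Mecke localisation ⇒ `ΔH ≥ e*·Δn` a.s. for countably many rules ⇒ `IsMuGSC` a.s. -/
theorem stub_equilibriumInLaw :
    UnimodularEnergyLowerBound →
      ∀ δ : ℝ, 0 < δ → ∀ P : Measure (Measure (EuclideanSpace ℝ (Fin 3))), IsProbabilityMeasure P →
        (∀ᵐ μ ∂P, IsRootedHardCore δ μ) → IsPointStationaryLaw P → meanRootEnergy P ≤ eStar →
        ∀ᵐ μ ∂P, ∃ S : Set (EuclideanSpace ℝ (Fin 3)),
          μ = (Measure.count : Measure (EuclideanSpace ℝ (Fin 3))).restrict S ∧ IsMuGSC lennardJones eStar S := by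
  sorry

/-- **stub_energyFloor** (S2 = DISCHARGE of route item 9229 `UnimodularEnergyLowerBound`, `e_uni ≥ e*` for every
point-stationary hard-core probability law; random-grid periodisation + `card_mul_eStar_le`). [L] -/
theorem stub_energyFloor : UnimodularEnergyLowerBound := by
  sorry

/-- **stub_dlrSurfaceOrder** (S3, the OPEN CORE, deterministic): badly-shelled atoms of a uniformly discrete e*-μGSC are
surface-order in every ball about every atom. [XL / open] -/
theorem stub_dlrSurfaceOrder :
    ∃ C : ℝ, ∀ S : Set (EuclideanSpace ℝ (Fin 3)), UniformlyDiscrete S → IsMuGSC lennardJones eStar S →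
      ∀ x ∈ S, ∀ R : ℝ, 1 ≤ R →
        ({y ∈ S | dist y x ≤ R ∧ ¬ GoodShell ((Measure.count : Measure (EuclideanSpace ℝ (Fin 3))).restrict
            ((fun z => z - y) '' S))}.ncard : ℝ) ≤ C * R ^ 2 := by
  sorry

/-- **stub_dlrVolumeGrowth** (S4, capillarity, deterministic): a uniformly discrete e*-μGSC has cubic volume growth
about every atom, with a uniform constant. [L–XL / open: needs particle-level positive surface tension] -/
theorem stub_dlrVolumeGrowth :
    ∃ c : ℝ, 0 < c ∧ ∀ S : Set (EuclideanSpace ℝ (Fin 3)), UniformlyDiscrete S → IsMuGSC lennardJones eStar S →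
      ∀ x ∈ S, ∀ R : ℝ, 1 ≤ R → c * R ^ 3 ≤ ({y ∈ S | dist y x ≤ R}.ncard : ℝ) := by
  sorry

/-- **stub_goodShellMeasurable** (S5; TRUE, M/L): the shell event is Giry-measurable modulo the hard-core class —
some measurable set of configurations agrees with `GoodShell` on every rooted hard-core counting measure. -/
theorem stub_goodShellMeasurable :
    ∃ B : Set (Measure (EuclideanSpace ℝ (Fin 3))), MeasurableSet B ∧
      ∀ δ : ℝ, 0 < δ → ∀ μ : Measure (EuclideanSpace ℝ (Fin 3)), IsRootedHardCore δ μ → (μ ∈ B ↔ GoodShell μ) := by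
  sorry

/-- **stub_palmDensity** (S6; TRUE, M): under a point-stationary hard-core probability law a.s. carried by
configurations whose badly-shelled atoms are surface-order about the root and whose atom counts grow cubically about
every atom, the root shell is a.s. good — one mass transport `g(μ, y) = 1[μ ∉ B]·1[‖y‖ ≤ R]/μ(B̄_R(0))`, giving
`P(bad root) ≤ C R²/(c R³)` for every `R ≥ 1`; the measurable `B` is the hypothesis (= S5). -/
theorem stub_palmDensity :
    (∃ B : Set (Measure (EuclideanSpace ℝ (Fin 3))), MeasurableSet B ∧
      ∀ δ : ℝ, 0 < δ → ∀ μ : Measure (EuclideanSpace ℝ (Fin 3)), IsRootedHardCore δ μ → (μ ∈ B ↔ GoodShell μ)) →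
    ∀ c C : ℝ, 0 < c → ∀ δ : ℝ, 0 < δ → ∀ P : Measure (Measure (EuclideanSpace ℝ (Fin 3))),
      IsProbabilityMeasure P → (∀ᵐ μ ∂P, IsRootedHardCore δ μ) → IsPointStationaryLaw P →
      (∀ᵐ μ ∂P, ∃ S : Set (EuclideanSpace ℝ (Fin 3)),
          μ = (Measure.count : Measure (EuclideanSpace ℝ (Fin 3))).restrict S ∧
          ∀ R : ℝ, 1 ≤ R →
            ({y ∈ S | dist y 0 ≤ R ∧ ¬ GoodShell ((Measure.count : Measure (EuclideanSpace ℝ (Fin 3))).restrict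
                ((fun z => z - y) '' S))}.ncard : ℝ) ≤ C * R ^ 2 ∧
              ∀ x ∈ S, c * R ^ 3 ≤ ({y ∈ S | dist y x ≤ R}.ncard : ℝ)) →
      ∀ᵐ μ ∂P, GoodShell μ := by
  sorry

/-! ## Composition (real proofs, no `sorry` below this line) -/

/-- Counting measures determine their carrier: `count|S = count|T → S = T`. [folklore] -/
theorem eq_of_count_restrict_eq {S T : Set (EuclideanSpace ℝ (Fin 3))}
    (h : (Measure.count : Measure (EuclideanSpace ℝ (Fin 3))).restrict S =
      (Measure.count : Measure (EuclideanSpace ℝ (Fin 3))).restrict T) : S = T := by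
  ext y
  rw [← count_restrict_singleton_ne_zero_iff S y, ← count_restrict_singleton_ne_zero_iff T y, h]

/-- **Composition (the skeleton theorem).**  The six stub STATEMENTS imply the crux `MinimiserShells`, concluded BY
NAME: the lever (fed with 9229) puts a.e. configuration in the e*-DLR class, surface order and volume growth bound its
bad atoms and its volume growth deterministically (configuration by configuration, the a.s. hard core identifying the
carrier), and the Palm density lemma (with the shell event's measurability) transfers to the root. -/
theorem MinimiserShells_of
    (hEq : UnimodularEnergyLowerBound →
      ∀ δ : ℝ, 0 < δ → ∀ P : Measure (Measure (EuclideanSpace ℝ (Fin 3))), IsProbabilityMeasure P →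
        (∀ᵐ μ ∂P, IsRootedHardCore δ μ) → IsPointStationaryLaw P → meanRootEnergy P ≤ eStar →
        ∀ᵐ μ ∂P, ∃ S : Set (EuclideanSpace ℝ (Fin 3)),
          μ = (Measure.count : Measure (EuclideanSpace ℝ (Fin 3))).restrict S ∧ IsMuGSC lennardJones eStar S)
    (hFloor : UnimodularEnergyLowerBound)
    (hSurf : ∃ C : ℝ, ∀ S : Set (EuclideanSpace ℝ (Fin 3)), UniformlyDiscrete S → IsMuGSC lennardJones eStar S →
      ∀ x ∈ S, ∀ R : ℝ, 1 ≤ R →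
        ({y ∈ S | dist y x ≤ R ∧ ¬ GoodShell ((Measure.count : Measure (EuclideanSpace ℝ (Fin 3))).restrict
            ((fun z => z - y) '' S))}.ncard : ℝ) ≤ C * R ^ 2)
    (hVol : ∃ c : ℝ, 0 < c ∧ ∀ S : Set (EuclideanSpace ℝ (Fin 3)), UniformlyDiscrete S →
      IsMuGSC lennardJones eStar S → ∀ x ∈ S, ∀ R : ℝ, 1 ≤ R → c * R ^ 3 ≤ ({y ∈ S | dist y x ≤ R}.ncard : ℝ))
    (hMeas : ∃ B : Set (Measure (EuclideanSpace ℝ (Fin 3))), MeasurableSet B ∧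
      ∀ δ : ℝ, 0 < δ → ∀ μ : Measure (EuclideanSpace ℝ (Fin 3)), IsRootedHardCore δ μ → (μ ∈ B ↔ GoodShell μ))
    (hPalm : (∃ B : Set (Measure (EuclideanSpace ℝ (Fin 3))), MeasurableSet B ∧
        ∀ δ : ℝ, 0 < δ → ∀ μ : Measure (EuclideanSpace ℝ (Fin 3)), IsRootedHardCore δ μ → (μ ∈ B ↔ GoodShell μ)) →
      ∀ c C : ℝ, 0 < c → ∀ δ : ℝ, 0 < δ → ∀ P : Measure (Measure (EuclideanSpace ℝ (Fin 3))),
        IsProbabilityMeasure P → (∀ᵐ μ ∂P, IsRootedHardCore δ μ) → IsPointStationaryLaw P →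
        (∀ᵐ μ ∂P, ∃ S : Set (EuclideanSpace ℝ (Fin 3)),
            μ = (Measure.count : Measure (EuclideanSpace ℝ (Fin 3))).restrict S ∧
            ∀ R : ℝ, 1 ≤ R →
              ({y ∈ S | dist y 0 ≤ R ∧ ¬ GoodShell ((Measure.count : Measure (EuclideanSpace ℝ (Fin 3))).restrict
                  ((fun z => z - y) '' S))}.ncard : ℝ) ≤ C * R ^ 2 ∧
                ∀ x ∈ S, c * R ^ 3 ≤ ({y ∈ S | dist y x ≤ R}.ncard : ℝ)) →
        ∀ᵐ μ ∂P, GoodShell μ) :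
    MinimiserShells := by
  rw [minimiserShells_iff]
  intro δ hδ P hP hcore hstat hE
  obtain ⟨C, hsurf⟩ := hSurf
  obtain ⟨c, hc, hvol⟩ := hVol
  have hdlr := hEq hFloor δ hδ P hP hcore hstat hE
  refine hPalm hMeas c C hc δ hδ P hP hcore hstat ?_
  filter_upwards [hcore, hdlr] with μ hμ hd
  obtain ⟨S, h0, hsep, rfl⟩ := hμ
  obtain ⟨T, hT, hgsc⟩ := hd
  obtain rfl : S = T := eq_of_count_restrict_eq hT
  have hud : UniformlyDiscrete S := ⟨δ, hδ, hsep⟩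
  exact ⟨S, rfl, fun R hR => ⟨hsurf S hud hgsc 0 h0 R hR, fun x hx => hvol S hud hgsc x hx R hR⟩⟩

/-- **The crux as a closed term over the six registered stubs** (becomes the crux proof when the last stub lands). -/
theorem MinimiserShells_proof : MinimiserShells :=
  MinimiserShells_of stub_equilibriumInLaw stub_energyFloor stub_dlrSurfaceOrder stub_dlrVolumeGrowth
    stub_goodShellMeasurable stub_palmDensity

end Summit.AtomisticToContinuum.Crystallization.Cruxes.MinimiserShells.EquilibriumInLawSurgery

end
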